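import Mathlib
import Literature.NumberTheory.Automorphic.AutomorphicGaloisConjProofs
import Literature.NumberTheory.Automorphic.AutomorphicRepsGLCuspidalL2Step3bHolds
import Literature.NumberTheory.Automorphic.GLnAdelicStructureProofs
import Literature.NumberTheory.Automorphic.GaloisActionPlaces
import Literature.NumberTheory.Automorphic.ChebotarevArtinRepHolds
import Literature.NumberTheory.GaloisRepresentations.KummerCharacters
import Literature.NumberTheory.GaloisRepresentations.AbsGaloisOuterConj
import HarnessLib
import Literature.NumberTheory.GaloisRepresentations.KummerCoherentFamiliesNotTauInvariant

/-!
# StubAdmissiblePowers — MOVED (deprecated alias module)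

Topic `Literature/Uncategorized`. Every declaration of this gate-parked module now lives,
byte-identical, in
`Literature/NumberTheory/GaloisRepresentations/KummerCoherentFamiliesNotTauInvariant.lean`
(namespace `Literature.NumberTheory.GaloisRepresentations`; librarian move 2026-08-16). This module
keeps the main constant as a deprecated reducible `abbrev` of the moved one and every other name as
a deprecated alias, so that importers keep compiling (deprecation warnings only); it can be deleted
once no module names `Literature.Uncategorized.StubAdmissiblePowers`.
-/

namespace Literature.Uncategorized

/-- DEPRECATED alias (librarian move 2026-08-16): this constant is, by definition, the moved
`Literature.NumberTheory.GaloisRepresentations.StubAdmissiblePowers`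
(statement byte-identical there); kept as a reducible `abbrev` so that files naming the old
constant keep elaborating. [folklore] -/
@[deprecated Literature.NumberTheory.GaloisRepresentations.StubAdmissiblePowers
  (since := "2026-08-16")]
abbrev StubAdmissiblePowers : Prop :=
  Literature.NumberTheory.GaloisRepresentations.StubAdmissiblePowers

@[deprecated Literature.NumberTheory.GaloisRepresentations.CoherentFamiliesTauInvariant
  (since := "2026-08-16")]
alias CoherentFamiliesTauInvariant :=
  Literature.NumberTheory.GaloisRepresentations.CoherentFamiliesTauInvariant

@[deprecated Literature.NumberTheory.GaloisRepresentations.outerConj_smul_kummerRoot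
  (since := "2026-08-16")]
alias outerConj_smul_kummerRoot :=
  Literature.NumberTheory.GaloisRepresentations.outerConj_smul_kummerRoot

@[deprecated Literature.NumberTheory.GaloisRepresentations.inflate_kummer_apply_coe
  (since := "2026-08-16")]
alias inflate_kummer_apply_coe :=
  Literature.NumberTheory.GaloisRepresentations.inflate_kummer_apply_coe

@[deprecated Literature.NumberTheory.GaloisRepresentations.rat_pow_three_ne_four
  (since := "2026-08-16")]
alias rat_pow_three_ne_four := Literature.NumberTheory.GaloisRepresentations.rat_pow_three_ne_four

@[deprecated Literature.NumberTheory.GaloisRepresentations.exists_coherentFamily_not_tauInvariant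
  (since := "2026-08-16")]
alias exists_coherentFamily_not_tauInvariant :=
  Literature.NumberTheory.GaloisRepresentations.exists_coherentFamily_not_tauInvariant

@[deprecated Literature.NumberTheory.GaloisRepresentations.coherentFamiliesTauInvariant_false
  (since := "2026-08-16")]
alias coherentFamiliesTauInvariant_false :=
  Literature.NumberTheory.GaloisRepresentations.coherentFamiliesTauInvariant_false

@[deprecated Literature.NumberTheory.GaloisRepresentations.nonempty_cuspidalAutomorphicRepData_zero
  (since := "2026-08-16")]
alias nonempty_cuspidalAutomorphicRepData_zero :=
  Literature.NumberTheory.GaloisRepresentations.nonempty_cuspidalAutomorphicRepData_zero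

@[deprecated Literature.NumberTheory.GaloisRepresentations.coherentFamiliesTauInvariant_of_stubB
  (since := "2026-08-16")]
alias coherentFamiliesTauInvariant_of_stubB :=
  Literature.NumberTheory.GaloisRepresentations.coherentFamiliesTauInvariant_of_stubB

@[deprecated Literature.NumberTheory.GaloisRepresentations.stubAdmissiblePowers_false_of
  (since := "2026-08-16")]
alias stubAdmissiblePowers_false_of :=
  Literature.NumberTheory.GaloisRepresentations.stubAdmissiblePowers_false_of

@[deprecated Literature.NumberTheory.GaloisRepresentations.stubAdmissiblePowers_false
  (since := "2026-08-16")]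
alias stubAdmissiblePowers_false :=
  Literature.NumberTheory.GaloisRepresentations.stubAdmissiblePowers_false

end Literature.Uncategorized
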